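import Summits.CriticalPhenomena.CardyFormulaZ2.Theorems.CardyUSTContinuationKirchhoffExtremalLengthG02Cross1
import Summits.CriticalPhenomena.CardyFormulaZ2.Theorems.CardyUSTContinuationKirchhoffExtremalLengthG02Interior
import Literature.Probability.LatticeModels.SquareTilingHoloLimit

/-!
# The conjugate in the bulk: step bounds, Lipschitz bounds, (CRd), second differences
# ([GP19] §4.1 for the `meshDomain` / `discreteArc` discretisation)

Support file for `KirchhoffExtremalLength` (route CardyUSTContinuation of `CardyFormulaZ2`, item
stmt-CriticalPhenomena-11234), towards the upper half of `G02ModulusConvergence` (`…Defs.lean`).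
Transposition of §L2 of the tree's `SquareTilingHoloLimit.lean` to `Ω_δ = discreteDomainGraph Ω δ`
(`facePot` of `…Defs.lean`), with the interior estimates of the potentials supplied by
`…G02Interior.lean` / `…G02Potential.lean` (`exists_forall_abs_sub_le'`,
`exists_forall_abs_second_diff_le'`): `abs_facePot_step_le`,
`exists_forall_abs_facePot_sub_le_mul_dist`, `facePot_step_eq` ((CRd) as an identity),
`exists_forall_abs_facePot_second_diff_le`.
-/

noncomputable section

namespace Summit.CriticalPhenomena.CardyFormulaZ2.Theorems

namespace KirchhoffSlope

open Set Metric Filter Topology SimpleGraph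
open Literature.Probability Literature.Probability.LatticeModels Literature.Probability.Percolation
open Literature.Probability.LatticeModels.SquareTiling (stepFlux walkFlux closedSq floorSq mem_closedSq_floorSq
  meshPoint_mem_closedSq dist_le_of_mem_closedSq stepFlux_left_eq stepFlux_down_eq stepFlux_right_eq stepFlux_up_eq
  abs_add_cornerUnit_sub_le abs_add_cornerUnit_add_sub_le crOff crDir crSgn crOff_apply_le abs_sub_le_mul_of_steps
  natAbs_add_natAbs_le)
open Literature.Probability.RandomPlanarGeometry

variable {Ω : Set ℂ} {δ : ℝ}

open WeakBeurling

open Classical in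
/-- **Interior gradient estimate for G02 potentials** (`abs_sub_le_of_harmonicOnBoxes` +
`exists_forall_isLatticeHarmonicOn_boxInterior`): if `B̄(z, r) ⊆ Ω`, for all small meshes every
potential of `Ω_δ` (harmonic off the discrete arcs of `(ab)`, `(cd)`, values in `[0,1]`)
satisfies `|h(x + eₖ) - h(x)| ≤ 32 K δ / r` at the lattice points with mesh point in `B(z, r/4)`.
[cite: GeorgakopoulosPanagiotis2019, §4.1] -/
theorem exists_forall_abs_sub_le' (R : ConformalRectangle) {z : ℂ} {r : ℝ} (hr : 0 < r) (hzr : closedBall z r ⊆ R.carrier) :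
    ∃ δ₀ > 0, ∀ δ, 0 < δ → δ < δ₀ → ∀ h : Site 2 → ℝ, (∀ x, h x ∈ Icc (0 : ℝ) 1) →
      (∀ x, x ∉ discreteArc R.carrier δ (R.arc 0) → x ∉ discreteArc R.carrier δ (R.arc 2) →
        ∑ y ∈ ((zdGraph 2).neighborFinset x).filter (fun y => (discreteDomainGraph R.carrier δ).Adj x y),
          (h y - h x) = 0) →
      ∀ x : Site 2, meshPoint δ x ∈ ball z (r / 4) → ∀ k : Fin 4,
        |h (x + cornerUnit k) - h x| ≤ 32 * topGradConst * δ / r := by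
  classical
  obtain ⟨δ₁, hδ₁, H⟩ := exists_forall_isLatticeHarmonicOn_boxInterior R.toJordanDomain (isCompact_closedBall z r) hzr
  refine ⟨min δ₁ (r / 72), by positivity, fun δ hδ hδlt h h01 hharm x hx k => ?_⟩
  exact abs_sub_le_of_harmonicOnBoxes hr hδ (hδlt.trans_le (min_le_right _ _)) h01
    (H δ hδ (hδlt.trans_le (min_le_left _ _)) _ _ h hharm) x hx k

open Classical in
/-- **Second-difference estimate for G02 potentials** (`abs_second_diff_le_of_harmonicOnBoxes`).
[cite: GeorgakopoulosPanagiotis2019, §4.1] -/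
theorem exists_forall_abs_second_diff_le' (R : ConformalRectangle) {z : ℂ} {r : ℝ} (hr : 0 < r)
    (hzr : closedBall z r ⊆ R.carrier) :
    ∃ δ₀ > 0, ∀ δ, 0 < δ → δ < δ₀ → ∀ h : Site 2 → ℝ, (∀ x, h x ∈ Icc (0 : ℝ) 1) →
      (∀ x, x ∉ discreteArc R.carrier δ (R.arc 0) → x ∉ discreteArc R.carrier δ (R.arc 2) →
        ∑ y ∈ ((zdGraph 2).neighborFinset x).filter (fun y => (discreteDomainGraph R.carrier δ).Adj x y),
          (h y - h x) = 0) →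
      ∀ x : Site 2, meshPoint δ x ∈ ball z (r / 16) → ∀ j k : Fin 4,
        |(h (x + cornerUnit k + cornerUnit j) - h (x + cornerUnit k)) - (h (x + cornerUnit j) - h x)| ≤
          4096 * topGradConst ^ 2 * δ ^ 2 / r ^ 2 := by
  classical
  obtain ⟨δ₁, hδ₁, H⟩ := exists_forall_isLatticeHarmonicOn_boxInterior R.toJordanDomain (isCompact_closedBall z r) hzr
  refine ⟨min δ₁ (r / 288), by positivity, fun δ hδ hδlt h h01 hharm x hx j k => ?_⟩
  exact abs_second_diff_le_of_harmonicOnBoxes hr hδ (hδlt.trans_le (min_le_right _ _)) h01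
    (H δ hδ (hδlt.trans_le (min_le_left _ _)) _ _ h hharm) x hx j k

/-- Across the left side: `h'(x - e₀) - h'(x) = h(x) - h(x + e₁)`. [folklore] -/
theorem stepFlux_left_ecur (h : Site 2 → ℝ) (x : Site 2) :
    stepFlux (ecurH Ω δ h) (ecurV Ω δ h) x (x - Pi.single 0 1) = ecur Ω δ h x (x + Pi.single 1 1) := by
  rw [stepFlux_left_eq, ecurV]
  congr 1 <;> rw [one_eq_single_add_single] <;> abel

/-- Across the bottom side: `h'(x - e₁) - h'(x) = -(h(x) - h(x + e₀))`. [folklore] -/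
theorem stepFlux_down_ecur (h : Site 2 → ℝ) (x : Site 2) :
    stepFlux (ecurH Ω δ h) (ecurV Ω δ h) x (x - Pi.single 1 1) = -ecur Ω δ h x (x + Pi.single 0 1) := by
  rw [stepFlux_down_eq, ecurH]
  congr 2 <;> rw [one_eq_single_add_single] <;> abel


/-- `|ecur x y| ≤ |h x - h y|`. [folklore] -/
theorem abs_ecur_le_abs_sub (h : Site 2 → ℝ) (x y : Site 2) : |ecur Ω δ h x y| ≤ |h x - h y| := by
  unfold ecur; split_ifs <;> simp

open Classical in
/-- **Step bound for the conjugate.** If the squares `x`, `x + cornerUnit k` are inner and the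
increments of `h` along the sides of `x` at `x`, `x + e₀`, `x + e₁` are at most `Bd`, then
`|h'(x + cornerUnit k) - h'(x)| ≤ Bd` (CR when `x` is in the component of the base, both values
`0` otherwise). [folklore] -/
theorem abs_facePot_step_le (R : ConformalRectangle) (hδ : 0 < δ) {h : Site 2 → ℝ} {T B : Set (Site 2)}
    (hT : T ⊆ meshBoundary R.carrier δ) (hB : B ⊆ meshBoundary R.carrier δ)
    (hharm : ∀ x, x ∉ T → x ∉ B →
      ∑ y ∈ ((zdGraph 2).neighborFinset x).filter (fun y => (discreteDomainGraph R.carrier δ).Adj x y), (h y - h x) = 0)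
    {p₀ : Site 2} (hp₀ : IsInnerFace R.carrier δ p₀) {Bd : ℝ} (hBd : 0 ≤ Bd) {x : Site 2} (k : Fin 4)
    (hx : IsInnerFace R.carrier δ x) (hxk : IsInnerFace R.carrier δ (x + cornerUnit k))
    (hstep : ∀ j : Fin 4, |h (x + cornerUnit j) - h x| ≤ Bd ∧ |h (x + Pi.single 0 1 + cornerUnit j) - h (x + Pi.single 0 1)| ≤ Bd ∧
      |h (x + Pi.single 1 1 + cornerUnit j) - h (x + Pi.single 1 1)| ≤ Bd) :
    |facePot R.carrier δ h p₀ (x + cornerUnit k) - facePot R.carrier δ h p₀ x| ≤ Bd := by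
  by_cases hr : (faceGraph R.carrier δ).Reachable p₀ x
  · have hadj : (faceGraph R.carrier δ).Adj x (x + cornerUnit k) :=
      faceGraph_adj_iff.2 ⟨adj_of_stepKind (stepKind_add_cornerUnit x k), hx, hxk⟩
    rw [facePot_sub_facePot_of_adj R hδ hT hB hharm hp₀ hr hadj]
    fin_cases k
    · -- right: the right side `{x + e₀, x + e₀ + e₁}`
      simp only [cornerUnit]
      rw [stepFlux_right_ecur, abs_neg]
      refine (abs_ecur_le_abs_sub h _ _).trans ?_
      rw [abs_sub_comm]
      simpa [cornerUnit] using (hstep 1).2.1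
    · -- up: the top side `{x + e₁, x + e₁ + e₀}`
      simp only [cornerUnit]
      rw [stepFlux_up_ecur]
      refine (abs_ecur_le_abs_sub h _ _).trans ?_
      rw [abs_sub_comm]
      simpa [cornerUnit] using (hstep 0).2.2
    · -- left: the left side `{x, x + e₁}`
      simp only [cornerUnit, ← sub_eq_add_neg]
      rw [stepFlux_left_ecur]
      refine (abs_ecur_le_abs_sub h _ _).trans ?_
      rw [abs_sub_comm]
      simpa [cornerUnit] using (hstep 1).1
    · -- down: the bottom side `{x, x + e₀}`
      simp only [cornerUnit, ← sub_eq_add_neg]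
      rw [stepFlux_down_ecur, abs_neg]
      refine (abs_ecur_le_abs_sub h _ _).trans ?_
      rw [abs_sub_comm]
      simpa [cornerUnit] using (hstep 0).1
  · have hr' : ¬ (faceGraph R.carrier δ).Reachable p₀ (x + cornerUnit k) := fun h' =>
      hr (h'.trans (faceGraph_adj_iff.2 ⟨(adj_of_stepKind (stepKind_add_cornerUnit x k)).symm, hxk, hx⟩).reachable)
    rw [facePot, dif_neg hr', facePot, dif_neg hr, sub_zero, abs_zero]
    exact hBd

open Classical in
/-- **Local equi-Lipschitz bound for the conjugate in the bulk** (the dual counterpart of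
`exists_forall_abs_sub_le_mul_dist`): if `B̄(z, r) ⊆ Ω`, then for all small meshes, for the
potential `h ∈ [0,1]` harmonic off `T_n ∪ B_n` and its conjugate `h'` based at any inner square,
`|h'(x) - h'(y)| ≤ (64 K / r) · dist` for squares with lower-left mesh points in `B(z, r/32)`.
[cite: GeorgakopoulosPanagiotis2019, Thm 4.3 (via (CRd))] -/
theorem exists_forall_abs_facePot_sub_le_mul_dist (R : ConformalRectangle)
    {z : ℂ} {r : ℝ} (hr : 0 < r) (hzr : closedBall z r ⊆ R.carrier) :
    ∃ δ₀ > 0, ∀ δ, 0 < δ → δ < δ₀ → ∀ h : Site 2 → ℝ, (∀ x, h x ∈ Icc (0 : ℝ) 1) →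
      (∀ x, x ∉ discreteArc R.carrier δ (R.arc 0) → x ∉ discreteArc R.carrier δ (R.arc 2) →
        ∑ y ∈ ((zdGraph 2).neighborFinset x).filter (fun y => (discreteDomainGraph R.carrier δ).Adj x y),
          (h y - h x) = 0) →
      ∀ p₀ : Site 2, IsInnerFace R.carrier δ p₀ →
      ∀ x y : Site 2, meshPoint δ x ∈ ball z (r / 32) → meshPoint δ y ∈ ball z (r / 32) →
        |facePot R.carrier δ h p₀ x - facePot R.carrier δ h p₀ y| ≤
          64 * topGradConst / r * dist (meshPoint δ x) (meshPoint δ y) := by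
  have hΩo : IsOpen R.carrier := R.isOpen
  have hΩc : IsConnected R.carrier := R.isConnected
  have hne : R.carrierᶜ.Nonempty := ⟨R.boundary 0, fun h =>
    (R.disjoint_carrier_frontier.ne_of_mem h (R.boundary_mem_frontier 0)) rfl⟩
  obtain ⟨δ₁, hδ₁, hstep⟩ := exists_forall_abs_sub_le' R hr hzr
  obtain ⟨δ₂, hδ₂, hinner⟩ := exists_forall_isInnerFace R.toJordanDomain hr hzr
  have hK := topGradConst_pos
  refine ⟨min (min δ₁ δ₂) (r / 64), by positivity, fun δ hδ hδlt h h01 hharm p₀ hp₀ x y hx hy => ?_⟩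
  have hδ₁' : δ < δ₁ := hδlt.trans_le ((min_le_left _ _).trans (min_le_left _ _))
  have hδ₂' : δ < δ₂ := hδlt.trans_le ((min_le_left _ _).trans (min_le_right _ _))
  have hδr : δ < r / 64 := hδlt.trans_le (min_le_right _ _)
  have hT : discreteArc R.carrier δ (R.arc 0) ⊆ meshBoundary R.carrier δ := fun _ hx => hx.1
  have hB : discreteArc R.carrier δ (R.arc 2) ⊆ meshBoundary R.carrier δ := fun _ hx => hx.1
  -- mesh points near a mesh point of `B(z, r/16)` are in `B(z, r/4)` and `B(z, r/2)`
  have hnear : ∀ x : Site 2, meshPoint δ x ∈ ball z (r / 16) → ∀ v : Site 2,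
      (|v 0 - x 0| ≤ 2 ∧ |v 1 - x 1| ≤ 2) → meshPoint δ v ∈ ball z (r / 4) := by
    intro x hx v hv
    have hd : dist (meshPoint δ v) (meshPoint δ x) ≤ 4 * δ := by
      rw [Complex.dist_eq]
      refine (Complex.norm_le_abs_re_add_abs_im _).trans ?_
      simp only [Complex.sub_re, Complex.sub_im, meshPoint_re, meshPoint_im, ← mul_sub, abs_mul, abs_of_pos hδ]
      rw [abs_le, abs_le] at hv
      have h1 : |((v 0 : ℝ)) - x 0| ≤ 2 := by rw [abs_le]; constructor <;> exact_mod_cast (by omega)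
      have h2 : |((v 1 : ℝ)) - x 1| ≤ 2 := by rw [abs_le]; constructor <;> exact_mod_cast (by omega)
      nlinarith [abs_nonneg ((v 0 : ℝ) - x 0), abs_nonneg ((v 1 : ℝ) - x 1)]
    rw [Metric.mem_ball] at hx ⊢
    linarith [dist_triangle (meshPoint δ v) (meshPoint δ x) z]
  have hstep' : ∀ x : Site 2, meshPoint δ x ∈ ball z (r / 16) → ∀ k : Fin 4,
      |facePot R.carrier δ h p₀ (x + cornerUnit k) - facePot R.carrier δ h p₀ x| ≤ 32 * topGradConst * δ / r := by
    intro x hx k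
    have hb4 := hnear x hx
    have hin : ∀ v : Site 2, (|v 0 - x 0| ≤ 2 ∧ |v 1 - x 1| ≤ 2) → IsInnerFace R.carrier δ v := fun v hv =>
      hinner δ hδ hδ₂' v (ball_subset_ball (by linarith) (hb4 v hv))
    refine abs_facePot_step_le R hδ hT hB hharm hp₀ (by positivity) k (hin x ⟨by simp, by simp⟩)
      (hin _ ?_) fun j => ⟨?_, ?_, ?_⟩
    · exact ⟨(abs_add_cornerUnit_sub_le x k 0).trans (by norm_num), (abs_add_cornerUnit_sub_le x k 1).trans (by norm_num)⟩
    · exact hstep δ hδ hδ₁' h h01 hharm x (hb4 x ⟨by simp, by simp⟩) j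
    · exact hstep δ hδ hδ₁' h h01 hharm _ (hb4 _ ⟨by simp, by simp⟩) j
    · exact hstep δ hδ hδ₁' h h01 hharm _ (hb4 _ ⟨by simp, by simp⟩) j
  have hRect : Complex.Rectangle (meshPoint δ x) (meshPoint δ y) ⊆ ball z (r / 16) := by
    have h2 : (2 : ℝ) * (r / 32) = r / 16 := by ring
    rw [← h2]
    exact rectangle_subset_ball (mem_ball.1 hx) (mem_ball.1 hy)
  have key := abs_sub_le_mul_of_steps hδ hstep' _ x y rfl hRect
  have hℓ := natAbs_add_natAbs_le hδ x y
  calc |facePot R.carrier δ h p₀ x - facePot R.carrier δ h p₀ y|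
      ≤ 32 * topGradConst * δ / r * (((y 0 - x 0).natAbs + (y 1 - x 1).natAbs : ℕ) : ℝ) := key
    _ = 32 * topGradConst / r * ((((y 0 - x 0).natAbs + (y 1 - x 1).natAbs : ℕ) : ℝ) * δ) := by ring
    _ ≤ 32 * topGradConst / r * (2 * dist (meshPoint δ x) (meshPoint δ y)) := by gcongr
    _ = 64 * topGradConst / r * dist (meshPoint δ x) (meshPoint δ y) := by ring




open Classical in
/-- **The CR-increments of the conjugate as increments of the potential**: for a square `y` of
the component of the base with `y + cornerUnit j` inner,
`h'(y + cornerUnit j) - h'(y) = crSgn j · (h(a) - h(a + cornerUnit (crDir j)))`, `a = y + crOff j`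
(the crossed side is an edge of `Ω_n` because `y` is inner). [cite: GeorgakopoulosPanagiotis2019, §4.1 (CRd)] -/
theorem facePot_step_eq (R : ConformalRectangle) (hδ : 0 < δ) {h : Site 2 → ℝ} {T B : Set (Site 2)}
    (hT : T ⊆ meshBoundary R.carrier δ) (hB : B ⊆ meshBoundary R.carrier δ)
    (hharm : ∀ x, x ∉ T → x ∉ B →
      ∑ y ∈ ((zdGraph 2).neighborFinset x).filter (fun y => (discreteDomainGraph R.carrier δ).Adj x y), (h y - h x) = 0)
    {p₀ : Site 2} (hp₀ : IsInnerFace R.carrier δ p₀) {y : Site 2} (hy : (faceGraph R.carrier δ).Reachable p₀ y)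
    (j : Fin 4) (hyj : IsInnerFace R.carrier δ (y + cornerUnit j)) :
    facePot R.carrier δ h p₀ (y + cornerUnit j) - facePot R.carrier δ h p₀ y =
      crSgn j * (h (y + crOff j) - h (y + crOff j + cornerUnit (crDir j))) := by
  have hyI : IsInnerFace R.carrier δ y := by
    obtain ⟨W⟩ := hy; exact isInnerFace_of_mem_support' hp₀ W (Walk.end_mem_support _)
  have hadj : (faceGraph R.carrier δ).Adj y (y + cornerUnit j) :=
    faceGraph_adj_iff.2 ⟨adj_of_stepKind (stepKind_add_cornerUnit y j), hyI, hyj⟩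
  rw [facePot_sub_facePot_of_adj R hδ hT hB hharm hp₀ hy hadj]
  obtain ⟨aB, aT, aL, aR⟩ := hyI
  fin_cases j
  · simp only [cornerUnit, crSgn, crOff, crDir, Fin.zero_eta, Fin.isValue, ↓reduceIte, true_or]
    rw [stepFlux_right_ecur, ecur_of_adj aR]; ring
  · simp only [cornerUnit, crSgn, crOff, crDir, Fin.mk_one, Fin.isValue, one_ne_zero, ↓reduceIte, false_or,
      show ¬ ((1 : Fin 4) = 2) by decide, show ¬ ((1 : Fin 4) = 3) by decide]
    rw [stepFlux_up_ecur, ecur_of_adj aT]; ring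
  · simp only [cornerUnit, crSgn, crOff, crDir, Fin.reduceFinMk, Fin.isValue, ↓reduceIte, or_true,
      show ¬ ((2 : Fin 4) = 0) by decide, show ¬ ((2 : Fin 4) = 1) by decide, show ¬ ((2 : Fin 4) = 3) by decide,
      false_or, ← sub_eq_add_neg, add_zero]
    rw [stepFlux_left_ecur, ecur_of_adj aL]; ring
  · simp only [cornerUnit, crSgn, crOff, crDir, Fin.reduceFinMk, Fin.isValue, ↓reduceIte, or_true,
      show ¬ ((3 : Fin 4) = 0) by decide, show ¬ ((3 : Fin 4) = 1) by decide, show ¬ ((3 : Fin 4) = 2) by decide,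
      false_or, ← sub_eq_add_neg, add_zero]
    rw [stepFlux_down_ecur, ecur_of_adj aB]; ring


open Classical in
/-- **Second differences of the conjugate in the bulk**: if `B̄(z, r) ⊆ Ω`, then for all small
meshes, for the potential `h ∈ [0,1]` harmonic off `T_n ∪ B_n` and its conjugate `h'` based at
any inner square, the mixed second differences of `h'` at squares with lower-left mesh point in
`B(z, r/32)` are at most `4096 K² δ² / r²` (they are second differences of `h`, by (CRd)).
[cite: GeorgakopoulosPanagiotis2019, §4.1] -/
theorem exists_forall_abs_facePot_second_diff_le (R : ConformalRectangle)
    {z : ℂ} {r : ℝ} (hr : 0 < r) (hzr : closedBall z r ⊆ R.carrier) :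
    ∃ δ₀ > 0, ∀ δ, 0 < δ → δ < δ₀ → ∀ h : Site 2 → ℝ, (∀ x, h x ∈ Icc (0 : ℝ) 1) →
      (∀ x, x ∉ discreteArc R.carrier δ (R.arc 0) → x ∉ discreteArc R.carrier δ (R.arc 2) →
        ∑ y ∈ ((zdGraph 2).neighborFinset x).filter (fun y => (discreteDomainGraph R.carrier δ).Adj x y),
          (h y - h x) = 0) →
      ∀ p₀ : Site 2, IsInnerFace R.carrier δ p₀ →
      ∀ x : Site 2, meshPoint δ x ∈ ball z (r / 32) → ∀ j k : Fin 4,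
        |(facePot R.carrier δ h p₀ (x + cornerUnit k + cornerUnit j) - facePot R.carrier δ h p₀ (x + cornerUnit k)) -
          (facePot R.carrier δ h p₀ (x + cornerUnit j) - facePot R.carrier δ h p₀ x)| ≤
          4096 * topGradConst ^ 2 * δ ^ 2 / r ^ 2 := by
  have hΩo : IsOpen R.carrier := R.isOpen
  have hΩc : IsConnected R.carrier := R.isConnected
  have hne : R.carrierᶜ.Nonempty := ⟨R.boundary 0, fun h =>
    (R.disjoint_carrier_frontier.ne_of_mem h (R.boundary_mem_frontier 0)) rfl⟩
  obtain ⟨δ₁, hδ₁, hsec⟩ := exists_forall_abs_second_diff_le' R hr hzr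
  obtain ⟨δ₂, hδ₂, hinner⟩ := exists_forall_isInnerFace R.toJordanDomain hr hzr
  have hK := topGradConst_pos
  refine ⟨min (min δ₁ δ₂) (r / 256), by positivity, fun δ hδ hδlt h h01 hharm p₀ hp₀ x hx j k => ?_⟩
  have hδ₁' : δ < δ₁ := hδlt.trans_le ((min_le_left _ _).trans (min_le_left _ _))
  have hδ₂' : δ < δ₂ := hδlt.trans_le ((min_le_left _ _).trans (min_le_right _ _))
  have hδr : δ < r / 256 := hδlt.trans_le (min_le_right _ _)
  have hT : discreteArc R.carrier δ (R.arc 0) ⊆ meshBoundary R.carrier δ := fun _ hx => hx.1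
  have hB : discreteArc R.carrier δ (R.arc 2) ⊆ meshBoundary R.carrier δ := fun _ hx => hx.1
  -- lattice points within three steps of `x` have mesh points in `B(z, r/16)`
  have hnear : ∀ v : Site 2, (|v 0 - x 0| ≤ 3 ∧ |v 1 - x 1| ≤ 3) → meshPoint δ v ∈ ball z (r / 16) := by
    intro v hv
    have hd : dist (meshPoint δ v) (meshPoint δ x) ≤ 6 * δ := by
      rw [Complex.dist_eq]
      refine (Complex.norm_le_abs_re_add_abs_im _).trans ?_
      simp only [Complex.sub_re, Complex.sub_im, meshPoint_re, meshPoint_im, ← mul_sub, abs_mul, abs_of_pos hδ]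
      rw [abs_le, abs_le] at hv
      have h1 : |((v 0 : ℝ)) - x 0| ≤ 3 := by rw [abs_le]; constructor <;> exact_mod_cast (by omega)
      have h2 : |((v 1 : ℝ)) - x 1| ≤ 3 := by rw [abs_le]; constructor <;> exact_mod_cast (by omega)
      nlinarith [abs_nonneg ((v 0 : ℝ) - x 0), abs_nonneg ((v 1 : ℝ) - x 1)]
    rw [Metric.mem_ball] at hx ⊢
    linarith [dist_triangle (meshPoint δ v) (meshPoint δ x) z]
  have hin : ∀ v : Site 2, (|v 0 - x 0| ≤ 3 ∧ |v 1 - x 1| ≤ 3) → IsInnerFace R.carrier δ v := fun v hv =>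
    hinner δ hδ hδ₂' v (ball_subset_ball (by linarith) (hnear v hv))
  -- inner squares involved
  have hxI : IsInnerFace R.carrier δ x := hin x ⟨by simp, by simp⟩
  have hxkI : IsInnerFace R.carrier δ (x + cornerUnit k) :=
    hin _ ⟨(abs_add_cornerUnit_sub_le x k 0).trans (by norm_num), (abs_add_cornerUnit_sub_le x k 1).trans (by norm_num)⟩
  have hxjI : IsInnerFace R.carrier δ (x + cornerUnit j) :=
    hin _ ⟨(abs_add_cornerUnit_sub_le x j 0).trans (by norm_num), (abs_add_cornerUnit_sub_le x j 1).trans (by norm_num)⟩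
  have hxkjI : IsInnerFace R.carrier δ (x + cornerUnit k + cornerUnit j) :=
    hin _ ⟨(abs_add_cornerUnit_add_sub_le x k j 0).trans (by norm_num), (abs_add_cornerUnit_add_sub_le x k j 1).trans (by norm_num)⟩
  by_cases hrx : (faceGraph R.carrier δ).Reachable p₀ x
  · have hrxk : (faceGraph R.carrier δ).Reachable p₀ (x + cornerUnit k) :=
      hrx.trans (faceGraph_adj_iff.2 ⟨adj_of_stepKind (stepKind_add_cornerUnit x k), hxI, hxkI⟩).reachable
    rw [facePot_step_eq R hδ hT hB hharm hp₀ hrxk j hxkjI, facePot_step_eq R hδ hT hB hharm hp₀ hrx j hxjI,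
      ← mul_sub, abs_mul]
    have hsgn : |crSgn j| = 1 := by unfold crSgn; split_ifs <;> simp
    rw [hsgn, one_mul]
    -- a second difference of `h` at `a = x + crOff j`
    have hoff := crOff_apply_le j
    have ha : meshPoint δ (x + crOff j) ∈ ball z (r / 16) := by
      refine hnear _ ⟨?_, ?_⟩ <;> simp <;> [exact hoff.1.trans (by norm_num); exact hoff.2.1.trans (by norm_num)]
    have key := hsec δ hδ hδ₁' h h01 hharm (x + crOff j) ha (crDir j) k
    rw [show x + cornerUnit k + crOff j = x + crOff j + cornerUnit k by abel]
    have e : (h (x + crOff j + cornerUnit k) - h (x + crOff j + cornerUnit k + cornerUnit (crDir j))) -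
        (h (x + crOff j) - h (x + crOff j + cornerUnit (crDir j))) =
        -((h (x + crOff j + cornerUnit k + cornerUnit (crDir j)) - h (x + crOff j + cornerUnit k)) -
          (h (x + crOff j + cornerUnit (crDir j)) - h (x + crOff j))) := by ring
    rw [e, abs_neg]
    exact key
  · -- off the component all four values vanish
    have hr1 : ¬ (faceGraph R.carrier δ).Reachable p₀ (x + cornerUnit k) := fun h' =>
      hrx (h'.trans (faceGraph_adj_iff.2 ⟨(adj_of_stepKind (stepKind_add_cornerUnit x k)).symm, hxkI, hxI⟩).reachable)
    have hr2 : ¬ (faceGraph R.carrier δ).Reachable p₀ (x + cornerUnit j) := fun h' =>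
      hrx (h'.trans (faceGraph_adj_iff.2 ⟨(adj_of_stepKind (stepKind_add_cornerUnit x j)).symm, hxjI, hxI⟩).reachable)
    have hr3 : ¬ (faceGraph R.carrier δ).Reachable p₀ (x + cornerUnit k + cornerUnit j) := fun h' =>
      hr1 (h'.trans (faceGraph_adj_iff.2 ⟨(adj_of_stepKind (stepKind_add_cornerUnit _ j)).symm, hxkjI, hxkI⟩).reachable)
    simp only [facePot, dif_neg hrx, dif_neg hr1, dif_neg hr2, dif_neg hr3, sub_self, abs_zero]
    positivity





end KirchhoffSlope

end Summit.CriticalPhenomena.CardyFormulaZ2.Theorems
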